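import Literature.NumberTheory.DiophantineGeometry.AVIsogenyTateHomKernelProofs
import HarnessLib

/-!
# Injectivity of the Tate map `ℤ_ℓ ⊗ Hom(A, B) → Hom(T_ℓ A, T_ℓ B)`: the closing forms

Third proof file for the named fact
`Literature.AlgebraicGeometry.Motives.AbelianVariety.faltingsTateMap_injective` of `AVIsogenyTate`
(D. Mumford, *Abelian Varieties*, §19, Theorem 3, second assertion; J. S. Milne, *Abelian Varieties*
(1986), Theorem 12.5: for every prime `ℓ` invertible in `K`, the natural map
`ℤ_ℓ ⊗_ℤ Hom_K(A, B) → Hom_{Γ_K}(T_ℓ A, T_ℓ B)` is injective), after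
`AVIsogenyTateInjectiveProofs` (Milne's Lemma 12.6 and the `ℓ`-adic argument:
`faltingsTateMap_injective_of_module_finite_hom`, the fact follows from the finite generation of
`Hom(A, B)` alone) and `AVIsogenyTateInjectiveSaturationProofs` (the fact from Step I alone).

The finite generation of `Hom(A, B)` (the named fact `module_finite_hom`, §19 Thm. 3, first
assertion) is assembled in this tree from the Theorem of the Cube (the named fact
`theoremOfCube_linEquiv`, Görtz–Wedhorn II Thm. 24.73, itself reduced to the named fact
`cechComplex_pseudoCoherent_general`, GW II Thm. 23.133 / Cor. 23.135) and two geometric inputs,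
Poincaré's complete reducibility theorem (§19 Thm. 1, hypothesis `hP1`, or its two-sided splitting
form `hP`) and "a non-zero homomorphism between simple abelian varieties is an isogeny" (§19 Cor. 2
of Thm. 1, hypothesis `hsimple`) — `AVIsogenyTateFinrankHomCubeProofs`; and `hsimple` is now a
theorem over algebraically closed fields (`hsimple_of_isAlgClosed`,
`Motives/AbelianVarietyKernelComponent`), whence
`module_finite_hom_of_theoremOfCube_of_poincare_algebraicClosure` (`AVIsogenyTateHomKernelProofs`:
Thm. 3 for all `A`, `B` over any `K` from the cube and `hP1` over `K̄`). This file records the same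
reductions for the Tate-map statement, i.e. the forms in which the discharge
`faltingsTateMap_injective_holds` will be a one-line application once `theoremOfCube_linEquiv_holds`
(or `cechComplex_pseudoCoherent_general_holds`) and a proof of Poincaré reducibility over
algebraically closed fields are in the tree:

* `AbelianVariety.faltingsTateMap_injective_of_theoremOfCube_of_poincare_algebraicClosure` — the
  fact for all `A`, `B` over `K` from `theoremOfCube_linEquiv` and `hP1` over `K̄` only;
* `AbelianVariety.faltingsTateMap_injective_of_pseudoCoherent_general_of_poincare_algebraicClosure` —
  the same from `cechComplex_pseudoCoherent_general` (the last unproved leaf of the cube);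
* `AbelianVariety.module_finite_hom_of_theoremOfCube_of_isogeny_biprod_algebraicClosure`,
  `AbelianVariety.faltingsTateMap_injective_of_theoremOfCube_of_isogeny_biprod_algebraicClosure` —
  the variants with Poincaré reducibility in the two-sided splitting form `hP` (§19 Thm. 1 with
  Cor. 1: a non-simple `X` admits isogenies `X₁ ⊞ X₂ → X → X₁ ⊞ X₂` with `dim Xᵢ < dim X`), again
  over `K̄` only and without `hsimple`.

The passage from `K̄` to `K` is the faithfulness of base change on `Hom`
(`module_finite_hom_of_baseChange`, `AVIsogenyTateHomProofs`; Milne 1986 states Thm. 12.5 over an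
arbitrary field, Mumford works over `k = k̄`), applied to finite generation — the Tate-map statement
over `K` then follows from finite generation over `K` (`faltingsTateMap_injective_of_module_finite_hom`),
so no comparison of Tate modules along `K ⊆ K̄` is needed.

## References

* [MumfordAV1970] D. Mumford, *Abelian Varieties*, TIFR Studies in Mathematics 5, OUP (1970; 2nd
  ed. 1974): §19, Thm. 1 with Cor. 1–2 (pp. 173–174), Thm. 3 and its proof (pp. 176–178). Not held;
  architecture as in Milne 1986.
* [Milne1986AbelianVarieties] J. S. Milne, *Abelian Varieties*, in: G. Cornell, J. H. Silverman
  (eds.), *Arithmetic Geometry*, Springer (1986): §12, Thm. 12.5 and Lemma 12.6 (held: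
  `book:cornellnd-arithmetic-geometry`, PDF pp. 190–192).
* [GortzWedhorn2023] U. Görtz, T. Wedhorn, *Algebraic Geometry II*, Springer Spektrum (2023):
  Thm. 24.73 (p. 550); Thm. 23.133 / Cor. 23.135 (pp. 478–480).

## Design

No definitions, no named facts (net debt delta 0); one-line compositions of theorems in the tree.
-/

universe u

open CategoryTheory CategoryTheory.Limits AlgebraicGeometry

noncomputable section

namespace Literature.NumberTheory.DiophantineGeometry

section AbelianVariety
open Literature.AlgebraicGeometry.Motives (AbelianVariety theoremOfCube_linEquiv
  cechComplex_pseudoCoherent_general theoremOfCube_linEquiv_of_pseudoCoherent_general)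
open Literature.AlgebraicGeometry.Motives.AbelianVariety

variable {K : Type u} [Field K]

/-! ### From the Theorem of the Cube and Poincaré reducibility (`hP1`) over `K̄` -/

/-- **Mumford §19, Theorem 3 (injectivity of `ℤ_ℓ ⊗ Hom(A, B) → Hom_{Γ_K}(T_ℓ A, T_ℓ B)` for every
prime `ℓ` invertible in `K`) from the Theorem of the Cube and Poincaré's complete reducibility
theorem over the algebraic closure.** If Poincaré reducibility (§19 Thm. 1: an abelian subvariety
`Y ⊂ X` with `0 < dim Y < dim X` has a complement `Z` with `Y ⊞ Z → X` an isogeny) holds over `K̄`,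
then the named fact `faltingsTateMap_injective A B` holds for all abelian varieties `A`, `B` over
`K`: it follows from the finite generation of `Hom_K(A, B)`
(`faltingsTateMap_injective_of_module_finite_hom`; Milne 1986, proof of Thm. 12.5 with Lemma 12.6),
which is `module_finite_hom_of_theoremOfCube_of_poincare_algebraicClosure` ("simple ⇒ isogeny",
§19 Cor. 2 of Thm. 1, being the theorem `hsimple_of_isAlgClosed` over `K̄`).
[cite: MumfordAV1970, §19 Thm. 3 (pp. 176–178)] [cite: Milne1986AbelianVarieties, Thm. 12.5 with Lemma 12.6 (PDF pp. 190–192)] -/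
theorem _root_.Literature.AlgebraicGeometry.Motives.AbelianVariety.faltingsTateMap_injective_of_theoremOfCube_of_poincare_algebraicClosure
    (hcube : theoremOfCube_linEquiv.{u})
    (hP1 : ∀ (X Y : AbelianVariety (AlgebraicClosure K)) (i : Y ⟶ X),
      IsClosedImmersion (Hom.toSchemeHom i) → 0 < Y.dim → Y.dim < X.dim →
      ∃ (Z : AbelianVariety (AlgebraicClosure K)) (j : Z ⟶ X),
        IsClosedImmersion (Hom.toSchemeHom j) ∧ IsIsogeny (biprod.desc i j))
    (A B : AbelianVariety K) : faltingsTateMap_injective A B :=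
  faltingsTateMap_injective_of_module_finite_hom A B
    (module_finite_hom_of_theoremOfCube_of_poincare_algebraicClosure hcube hP1 A B)

/-- **Mumford §19, Theorem 3 (injectivity of the Tate map) from the pseudo-coherence of the Čech
complex of `𝒪(D)` and Poincaré reducibility over the algebraic closure** — the current trust base of
the named fact `faltingsTateMap_injective A B` in this tree: one named fact
(`cechComplex_pseudoCoherent_general`, Görtz–Wedhorn II, Thm. 23.133 / Cor. 23.135: finiteness of
coherent cohomology of proper morphisms, in Čech form, from which the Theorem of the Cube is
`theoremOfCube_linEquiv_of_pseudoCoherent_general`) and one printed statement over `K̄` (`hP1`,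
§19 Thm. 1). [cite: MumfordAV1970, §19 Thm. 3 (pp. 176–178)]
[cite: GortzWedhorn2023, Thm. 24.73 (p. 550) with Thm. 23.133 / Cor. 23.135 (pp. 478–480)] -/
theorem _root_.Literature.AlgebraicGeometry.Motives.AbelianVariety.faltingsTateMap_injective_of_pseudoCoherent_general_of_poincare_algebraicClosure
    (h : cechComplex_pseudoCoherent_general.{u})
    (hP1 : ∀ (X Y : AbelianVariety (AlgebraicClosure K)) (i : Y ⟶ X),
      IsClosedImmersion (Hom.toSchemeHom i) → 0 < Y.dim → Y.dim < X.dim →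
      ∃ (Z : AbelianVariety (AlgebraicClosure K)) (j : Z ⟶ X),
        IsClosedImmersion (Hom.toSchemeHom j) ∧ IsIsogeny (biprod.desc i j))
    (A B : AbelianVariety K) : faltingsTateMap_injective A B :=
  faltingsTateMap_injective_of_theoremOfCube_of_poincare_algebraicClosure
    (theoremOfCube_linEquiv_of_pseudoCoherent_general h) hP1 A B

/-! ### From the Theorem of the Cube and the two-sided splitting form `hP` over `K̄` -/

open Classical in
/-- **Mumford §19, Theorem 3 (`Hom(A, B)` finitely generated) over an arbitrary field from the
Theorem of the Cube and Poincaré reducibility in two-sided splitting form over the algebraic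
closure.** If every non-simple abelian variety `X` over `K̄` admits isogenies `X₁ ⊞ X₂ → X` and
`X → X₁ ⊞ X₂` with `dim Xᵢ < dim X` (§19 Thm. 1 with Cor. 1 and the Remark on p. 169), then
`Hom_K(A, B)` is finitely generated for all `A`, `B` over `K`:
`module_finite_hom_of_theoremOfCube_of_isogeny_biprod` over `K̄`, with "simple ⇒ isogeny" (§19
Cor. 2 of Thm. 1) supplied by `hsimple_of_isAlgClosed`, descended along
`Hom_K(A, B) ↪ Hom_K̄(A_K̄, B_K̄)` (`module_finite_hom_of_baseChange`).
[cite: MumfordAV1970, §19 Thm. 3 (pp. 176–178)] [cite: Milne1986AbelianVarieties, Thm. 12.5 (PDF p. 190)] -/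
theorem _root_.Literature.AlgebraicGeometry.Motives.AbelianVariety.module_finite_hom_of_theoremOfCube_of_isogeny_biprod_algebraicClosure
    (hcube : theoremOfCube_linEquiv.{u})
    (hP : ∀ X : AbelianVariety (AlgebraicClosure K), ¬ IsSimple X →
      ∃ X₁ X₂ : AbelianVariety (AlgebraicClosure K),
        X₁.dim < X.dim ∧ X₂.dim < X.dim ∧ (∃ σ : X₁ ⊞ X₂ ⟶ X, IsIsogeny σ) ∧
          ∃ τ : X ⟶ X₁ ⊞ X₂, IsIsogeny τ)
    (A B : AbelianVariety K) : module_finite_hom A B :=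
  module_finite_hom_of_baseChange (A := A) (B := B) (AlgebraicClosure K)
    (module_finite_hom_of_theoremOfCube_of_isogeny_biprod hcube
      (hsimple_of_isAlgClosed (AlgebraicClosure K)) hP _ _)

/-- **Mumford §19, Theorem 3 (injectivity of the Tate map) from the Theorem of the Cube and
Poincaré reducibility in two-sided splitting form over the algebraic closure**:
`faltingsTateMap_injective_of_module_finite_hom` with
`module_finite_hom_of_theoremOfCube_of_isogeny_biprod_algebraicClosure`.
[cite: MumfordAV1970, §19 Thm. 3 (pp. 176–178)] [cite: Milne1986AbelianVarieties, Thm. 12.5 with Lemma 12.6 (PDF pp. 190–192)] -/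
theorem _root_.Literature.AlgebraicGeometry.Motives.AbelianVariety.faltingsTateMap_injective_of_theoremOfCube_of_isogeny_biprod_algebraicClosure
    (hcube : theoremOfCube_linEquiv.{u})
    (hP : ∀ X : AbelianVariety (AlgebraicClosure K), ¬ IsSimple X →
      ∃ X₁ X₂ : AbelianVariety (AlgebraicClosure K),
        X₁.dim < X.dim ∧ X₂.dim < X.dim ∧ (∃ σ : X₁ ⊞ X₂ ⟶ X, IsIsogeny σ) ∧
          ∃ τ : X ⟶ X₁ ⊞ X₂, IsIsogeny τ)
    (A B : AbelianVariety K) : faltingsTateMap_injective A B :=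
  faltingsTateMap_injective_of_module_finite_hom A B
    (module_finite_hom_of_theoremOfCube_of_isogeny_biprod_algebraicClosure hcube hP A B)

end AbelianVariety

end Literature.NumberTheory.DiophantineGeometry

end
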